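import Summits.BirchSwinnertonDyer.BirchSwinnertonDyer.Theses.PrintCf2
import Summits.BirchSwinnertonDyer.BirchSwinnertonDyer.Theorems.PrintCf2RamifiedOffTYZLowerHalfVisibleSevenDisplay
import HarnessLib

/-!
# `PrintCf2.RamifiedLowerHalfVisibleSevenDisplayOfFacts` holds (aside stmt-BirchSwinnertonDyer-28694, route PrintCf2)

Cell `bsd-print-cf2`, referee batch b2 (2026-08-30): the promotion-independent (display-as-hypothesis) form of the
VisibleSeven aside — its text is literally the type of cruxlead-20509 g17's
`Summit.BirchSwinnertonDyer.PrintCf2.LowerHalfVisible.two_dvd_scriptL_of_visible_of_display` (p762616). Pure plumbing: one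
term. No summit statement is proved here; the aside is conditional on GZK and the per-`n` TYZ display hypothesis; BSD is
not proved by any of this.
-/

set_option autoImplicit false
set_option linter.dupNamespace false

namespace Summit.BirchSwinnertonDyer.BirchSwinnertonDyer.Theorems.PrintCf2

/-- The aside `RamifiedLowerHalfVisibleSevenDisplayOfFacts` of route `PrintCf2` (item stmt-BirchSwinnertonDyer-28694) holds:
cruxlead-20509 g17's `LowerHalfVisible.two_dvd_scriptL_of_visible_of_display` (p762616), types literally equal. -/
theorem ramifiedLowerHalfVisibleSevenDisplayOfFacts_proof :
    Summit.BirchSwinnertonDyer.BirchSwinnertonDyer.Theses.PrintCf2.RamifiedLowerHalfVisibleSevenDisplayOfFacts :=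
  Summit.BirchSwinnertonDyer.PrintCf2.LowerHalfVisible.two_dvd_scriptL_of_visible_of_display

end Summit.BirchSwinnertonDyer.BirchSwinnertonDyer.Theorems.PrintCf2
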